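import Summits.QuantumFields.BalabanUV.T4Continuum.Support.NE3FrameFreeDecompositionW
import Summits.QuantumFields.BalabanUV.T4Continuum.Support.NE3RightInverseLetters
import Summits.QuantumFields.BalabanUV.T4Continuum.Support.NE3ResidualSliceRep
import Summits.QuantumFields.BalabanUV.T4Continuum.Support.NE3EnergyRateWSupRoutePiRInv
import HarnessLib

/-!
# Support | NE7 (gen 95, brick (S1)-A of memo WEIGHT-CURRENCY-DEAD §§7–8): THE LINEAR SPLIT OF AN ARBITRARY DIRECTION INTO SLICE + RESIDUAL GAUGE + NORMAL PART —
# `X = X_T + (rightInvW (D X) − gaugeDir W μ)`, `X_T ∈ T_♮(W)`, `μ` corner-trivial — and PYTHAGORAS FOR THE RIESZ GAUGE COMPONENT (its Hilbert–Schmidt mass is below the field's)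

Cell `pub-balaban`, rung (B)+1 sub-cell t4, lineage `b2b-balaban-t4-ne7-p1` (CRUX PROVER NE7 #1 = OWNER of row NE7), generation 95.  Over row NE3's kernel theorems BY NAME: the exact
right inverse `NE3SmoothRightInverseW.rightInvW` (`dirIter ∘ rightInvW = id`), leaf-02's decomposition on the tangent space
`NE3FrameFreeDecompositionW.exists_cornerGauge_mem_frameFreeBlockLandauW` (`ker D ∩ {skew, periodic} = gaugeDir W (Ξ₀) ⊕ T_♮(W)`), and leaf-02's Riesz projection
`NE3FrameFreeSliceW.exists_orthogonalW_of_le`.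

WHY.  The honest per-pair binder `hdecomp` of the NE7 record (F326∕F327, END `NE7HintOfSliceNormalisationSU2Dec.hint_SU2_of_decomposition`) asks a decomposition `X = X_T + X_N`,
`X_T ∈ T_♮(U♯)`, with ENERGY letters on `X_N`; its supplier (memo §7 (S1)) starts from gen 94's residual near-representative `X⁰` and the LINEAR split of this file:
`X⁰ = X_T + X_N` with `X_N = rightInvW(D X⁰) − gaugeDir W μ` — EXACT, no estimate — after which only LETTERS remain ((A) the size of `gaugeDir W μ`, (B) the residue of one
nonlinear gauge step, (C) the direct letters of `D X`).  §2 gives the free half of (A): the Riesz component's Hilbert–Schmidt mass and the moved field's are below the field's.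
WHAT ([folklore]; 0 def, 0 sorry).  §1 **`exists_linear_split`** (class = unitary `W` of period `N·L^{k+1}`, `LevelSmall d L k x`, `SmallField W x`, W6 regime `cruxC·(M²x) < 1`,
`2 ≤ L^d`; any skew periodic `X`): `∃ μ` skew periodic corner-trivial with `X − rightInvW(D X) + gaugeDir W μ ∈ T_♮(W)`.  §2 **`riesz_pythagoras`**: if `η ∈ S` and
`Σ hsR (Y + gaugeDir W η) (gaugeDir W ζ) = 0` for all `ζ ∈ S` then `Σ nhsNormSq (gaugeDir W η) + Σ nhsNormSq (Y + gaugeDir W η) = Σ nhsNormSq Y`; corollaries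
`sum_nhsNormSq_gaugeDir_riesz_le`, `sum_nhsNormSq_add_riesz_le`.
HONEST FRAMING (page 1): exact linear algebra over landed theorems; no estimate beyond Pythagoras; nothing of Bałaban's asserted; the frame-kill component's size, the nonlinear step and the
direct letters are NOT here; NE7 NOT PROVED; spine 0∕9; finite T⁴ rung (B)+1 — NOT infinite volume, NOT mass gap, NOT `BetaPertH`, NOT Clay.  Continuum YM on T⁴ ⇐ BetaPertH ∧ nine
spine estimates (0/9 proved); BetaPertH ⇐ (D1) ∧ (D4) ∧ CAP+tail; G-an2-4 gates asym, D1 and NE2/3/4.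
-/

set_option autoImplicit false

open scoped BigOperators Matrix.Norms.L2Operator
open Finset

namespace Summit.QuantumFields.BalabanUV.T4Continuum.NE7SliceLinearSplit

open Literature.MathematicalPhysics.QuantumFieldTheory.Balaban1983to89
open B7Prop1Explicit B7Prop2Explicit
open T4AveragingDeficitWall (IsUnitaryCfg IsSkewDir SmallField)
open T4AveragingDeficitWallBoundary (IsPeriodicCfg periodBox)
open AveragingDeficitPeriodicCounting (IsPeriodicDir)
open AveragingDeficitMultiLevelPrep (tower TangentIter LevelSmall)
open BlockAveragePushDirGauge (gaugeDir)
open NE3CovariantCalculus (hsR hsR_add_left hsR_self nhsNormSq_sub)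
open MatrixNorms (nhsNormSq nhsNormSq_nonneg)
open NE3TangentCovariantTower (dirIter tangentIter_iff_dirIter_eq_zero)
open NE3FrameFreeSliceW (frameFreeBlockLandauW)
open NE3FrameFreeDecompositionW (exists_cornerGauge_mem_frameFreeBlockLandauW)
open NE3QbarIterCovLiftPrep (cruxC)
open NE3SmoothRightInverseW (rightInvW dirIter_rightInvW)
open NE3RightInverseLetters (rightInvW_skew rightInvW_periodic)
open NE3ResidualSliceRep (dirIter_sub)
open NE3EnergyRateWSupRoutePiRInv (dirIter_skew isPeriodicDir_dirIter)
open NE3FramePotBoundW (tower_eq_pow_mul)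

noncomputable section
variable {d : ℕ} {n : Type*} [Fintype n] [DecidableEq n]

/-! ## §1 The linear split of an arbitrary direction -/

/-- **THE LINEAR SPLIT** (level `k+1`, `M = L^{k+1}`, class background `W` of period `N·M`, `2 ≤ L^d`): every skew `(N·M)`-periodic `X` has a skew periodic CORNER-TRIVIAL `μ`
(`μ (M•w) = 0`) with `X − rightInvW(D X) + gaugeDir W μ ∈ T_♮(W)` — i.e. `X = X_T + X_N`, `X_T ∈ frameFreeBlockLandauW L N (k+1) W`, `X_N = rightInvW(D X) − gaugeDir W μ`.
(`X − rightInvW(D X)` is tangent by `dirIter ∘ rightInvW = id`; then leaf-02's decomposition of the tangent space.) [folklore] -/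
theorem exists_linear_split [Nonempty n] {L N : ℕ} [NeZero L] [NeZero N] (hL : 2 ≤ L) (hLd : 2 ≤ L ^ d) (k : ℕ)
    {W : Site d → Fin d → (Matrix n n ℂ)ˣ} {x : ℝ} (hWu : IsUnitaryCfg W) (hWP : IsPeriodicCfg W ((N * L ^ (k + 1) : ℕ) : ℤ)) (hx : 0 ≤ x)
    (hs : LevelSmall d L k x) (hWx : SmallField W x) (hθ : cruxC d L * (((L : ℝ) ^ (k + 1)) ^ 2 * x) < 1)
    {X : Site d → Fin d → Matrix n n ℂ} (hXs : IsSkewDir X) (hXP : IsPeriodicDir X ((N * L ^ (k + 1) : ℕ) : ℤ)) :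
    ∃ mu : Site d → Matrix n n ℂ, (∀ y, mu y ∈ skewAdjoint (Matrix n n ℂ))
      ∧ (∀ (y : Site d) (i : Fin d), mu (y + ((N * L ^ (k + 1) : ℕ) : ℤ) • e i) = mu y)
      ∧ (∀ w : Site d, mu (((L : ℤ) ^ (k + 1)) • w) = 0)
      ∧ (fun y ν => (X y ν - rightInvW hL k hWu hx hs hWx N hθ (dirIter_skew (by omega) k hWu hx hs hWx hXs) y ν) + gaugeDir W mu y ν)
          ∈ frameFreeBlockLandauW (d := d) (n := n) L N (k + 1) W := by
  have hL1 : 1 ≤ L := by omega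
  have hT : ((tower L N (k + 1) : ℕ) : ℤ) = ((N * L ^ (k + 1) : ℕ) : ℤ) := by rw [tower_eq_pow_mul, Nat.mul_comm]
  have hWPt : IsPeriodicCfg W ((tower L N (k + 1) : ℕ) : ℤ) := by rw [hT]; exact hWP
  have hφs : IsSkewDir (dirIter L (k + 1) W X) := dirIter_skew hL1 k hWu hx hs hWx hXs
  set Nn := rightInvW hL k hWu hx hs hWx N hθ hφs with hNn
  -- `Y := X − Nn` is skew, periodic and tangent
  set Y : Site d → Fin d → Matrix n n ℂ := fun y ν => X y ν - Nn y ν with hYdef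
  have hNs : IsSkewDir Nn := rightInvW_skew hL k hWu hx hs hWx hθ hφs
  have hNP : IsPeriodicDir Nn ((N * L ^ (k + 1) : ℕ) : ℤ) := rightInvW_periodic hL k hWu hWPt hx hs hWx hθ hφs
  have hYs : IsSkewDir Y := fun y ν => (skewAdjoint (Matrix n n ℂ)).sub_mem (hXs y ν) (hNs y ν)
  have hYP : IsPeriodicDir Y ((tower L N (k + 1) : ℕ) : ℤ) := by
    rw [hT]; intro y i ν; simp only [hYdef]; rw [hXP y i ν, hNP y i ν]
  have hφP : IsPeriodicDir (dirIter L (k + 1) W X) (N : ℤ) := isPeriodicDir_dirIter L N (k + 1) hWPt (by rw [hT]; exact hXP)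
  have hYT : TangentIter L k W Y := by
    rw [tangentIter_iff_dirIter_eq_zero, hYdef, dirIter_sub hL1 k hWu hx hs hWx X Nn, hNn,
      dirIter_rightInvW hL k hWu hWPt hx hs hWx hθ hφs hφP]
    funext z κ; simp
  obtain ⟨mu, hmus, hmuP, hmu0, hmem⟩ := exists_cornerGauge_mem_frameFreeBlockLandauW (M := N) hL1 hLd k hWu hWPt hx hs hWx hYs hYP hYT
  refine ⟨mu, hmus, fun y i => by rw [← hT]; exact hmuP y i, hmu0, ?_⟩
  exact hmem

/-! ## §2 Pythagoras for the Riesz gauge component -/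

/-- **PYTHAGORAS FOR THE RIESZ COMPONENT**: if `η ∈ S` and `Y + gaugeDir W η` is `hsR`-orthogonal over `F` to `gaugeDir W ζ` for every `ζ ∈ S`, then
`Σ_F nhsNormSq (gaugeDir W η) + Σ_F nhsNormSq (Y + gaugeDir W η) = Σ_F nhsNormSq Y` — exact, at any background. [folklore] -/
theorem riesz_pythagoras {W : Site d → Fin d → (Matrix n n ℂ)ˣ} {S : Submodule ℝ (Site d → Matrix n n ℂ)} {F : Finset (Site d)}
    {Y : Site d → Fin d → Matrix n n ℂ} {η : Site d → Matrix n n ℂ} (hη : η ∈ S)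
    (horth : ∀ ζ ∈ S, ∑ x ∈ F, ∑ μ : Fin d, hsR (Y x μ + gaugeDir W η x μ) (gaugeDir W ζ x μ) = 0) :
    (∑ x ∈ F, ∑ μ : Fin d, nhsNormSq (gaugeDir W η x μ)) + ∑ x ∈ F, ∑ μ : Fin d, nhsNormSq (Y x μ + gaugeDir W η x μ)
      = ∑ x ∈ F, ∑ μ : Fin d, nhsNormSq (Y x μ) := by
  have h0 := horth η hη
  -- pointwise: `nhs Y = nhs ((Y + g) − g) = nhs (Y+g) + nhs g − 2 hsR (Y+g) g`
  have hpt : ∀ (x : Site d) (μ : Fin d), nhsNormSq (Y x μ) = nhsNormSq (Y x μ + gaugeDir W η x μ) + nhsNormSq (gaugeDir W η x μ)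
      - 2 * hsR (Y x μ + gaugeDir W η x μ) (gaugeDir W η x μ) := by
    intro x μ
    have e : Y x μ = (Y x μ + gaugeDir W η x μ) - gaugeDir W η x μ := by abel
    conv_lhs => rw [e]
    exact nhsNormSq_sub _ _
  calc (∑ x ∈ F, ∑ μ : Fin d, nhsNormSq (gaugeDir W η x μ)) + ∑ x ∈ F, ∑ μ : Fin d, nhsNormSq (Y x μ + gaugeDir W η x μ)
      = (∑ x ∈ F, ∑ μ : Fin d, nhsNormSq (gaugeDir W η x μ)) + (∑ x ∈ F, ∑ μ : Fin d, nhsNormSq (Y x μ + gaugeDir W η x μ))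
          - 2 * ∑ x ∈ F, ∑ μ : Fin d, hsR (Y x μ + gaugeDir W η x μ) (gaugeDir W η x μ) := by rw [h0, mul_zero, sub_zero]
    _ = ∑ x ∈ F, ∑ μ : Fin d, (nhsNormSq (Y x μ + gaugeDir W η x μ) + nhsNormSq (gaugeDir W η x μ)
          - 2 * hsR (Y x μ + gaugeDir W η x μ) (gaugeDir W η x μ)) := by
        simp only [Finset.sum_add_distrib, Finset.sum_sub_distrib, Finset.mul_sum]; ring
    _ = ∑ x ∈ F, ∑ μ : Fin d, nhsNormSq (Y x μ) := by
        refine Finset.sum_congr rfl fun x _ => Finset.sum_congr rfl fun μ _ => (hpt x μ).symm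

/-- **THE RIESZ GAUGE COMPONENT IS DOMINATED BY THE FIELD** (Hilbert–Schmidt mass): `Σ nhsNormSq (gaugeDir W η) ≤ Σ nhsNormSq Y`. [folklore] -/
theorem sum_nhsNormSq_gaugeDir_riesz_le {W : Site d → Fin d → (Matrix n n ℂ)ˣ} {S : Submodule ℝ (Site d → Matrix n n ℂ)} {F : Finset (Site d)}
    {Y : Site d → Fin d → Matrix n n ℂ} {η : Site d → Matrix n n ℂ} (hη : η ∈ S)
    (horth : ∀ ζ ∈ S, ∑ x ∈ F, ∑ μ : Fin d, hsR (Y x μ + gaugeDir W η x μ) (gaugeDir W ζ x μ) = 0) :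
    ∑ x ∈ F, ∑ μ : Fin d, nhsNormSq (gaugeDir W η x μ) ≤ ∑ x ∈ F, ∑ μ : Fin d, nhsNormSq (Y x μ) := by
  have h := riesz_pythagoras (W := W) hη horth
  have h2 : 0 ≤ ∑ x ∈ F, ∑ μ : Fin d, nhsNormSq (Y x μ + gaugeDir W η x μ) :=
    Finset.sum_nonneg fun _ _ => Finset.sum_nonneg fun _ _ => nhsNormSq_nonneg _
  linarith

/-- **THE MOVED FIELD IS DOMINATED BY THE FIELD**: `Σ nhsNormSq (Y + gaugeDir W η) ≤ Σ nhsNormSq Y`. [folklore] -/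
theorem sum_nhsNormSq_add_riesz_le {W : Site d → Fin d → (Matrix n n ℂ)ˣ} {S : Submodule ℝ (Site d → Matrix n n ℂ)} {F : Finset (Site d)}
    {Y : Site d → Fin d → Matrix n n ℂ} {η : Site d → Matrix n n ℂ} (hη : η ∈ S)
    (horth : ∀ ζ ∈ S, ∑ x ∈ F, ∑ μ : Fin d, hsR (Y x μ + gaugeDir W η x μ) (gaugeDir W ζ x μ) = 0) :
    ∑ x ∈ F, ∑ μ : Fin d, nhsNormSq (Y x μ + gaugeDir W η x μ) ≤ ∑ x ∈ F, ∑ μ : Fin d, nhsNormSq (Y x μ) := by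
  have h := riesz_pythagoras (W := W) hη horth
  have h1 : 0 ≤ ∑ x ∈ F, ∑ μ : Fin d, nhsNormSq (gaugeDir W η x μ) :=
    Finset.sum_nonneg fun _ _ => Finset.sum_nonneg fun _ _ => nhsNormSq_nonneg _
  linarith

end

end Summit.QuantumFields.BalabanUV.T4Continuum.NE7SliceLinearSplit
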